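import Literature.Probability.Percolation.SlabRSWGluingSegment
import HarnessLib

/-!
# Newman–Tassion–Wu 2017, §3.2 — the gluing lemma GL (Thm. 3.7) with `S ⊊ R`: the extended rectangle

Topic: `Literature/Probability/Percolation`. The files `SlabRSWGluing{Geometry,Linear,Rect,Segment}.lean`
construct the local modifications of NTW's gluing lemma in a rectangle `S = R` (Thm. 3.6, GL0). The MAIN
gluing lemma (Thm. 3.7, GL) has two domains `S ⊆ R`: the minimal path `Γ = Γ_min^S(A, B)` lives in `S̄`,
the glued connection `C ⟷^R A` and the contact `C̄ ⟷^{R̄} 𝒩(Γ̄, r)` live in the larger `R̄`. Its one use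
in §3 is Case 2 of the proof of the RSW Theorem 3.14 (`S = [0,7n]×[0,8n]`, `R = [-7n,7n]×[0,13n]`,
`A = X`, `B = L(S)`, `C = Y`): after the reflection `x ↦ 7n - x` this is the **extended-rectangle
setting** of this file — `S = [a,b]×[c,d] ⊆ R = [a,b']×[c,d']` (`R` extends `S` to the right and to the
top, the orientation of the tree's routing theorem `exists_route`), target `B = {b}×[c,d]` the FULL right
side of `S` (a column in the interior of `R`), `A ⊆ S` off that column, `C ⊆ R`.

This file: the setting (`ExtSetup`), the plain rerouting surgery when the cleared box stays left of the
column `x = b` (trunk box `= box ∩ S`, branch box `= box ∩ R`, a top extension), and the two direct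
gluings (near `A`, near `C`) with the `C`-path living in `R̄`. The surgery for boxes reaching the column
`x = b` (where the `C`-path may arrive from the right, behind `B̄`), the trichotomy and the linear bound
are in `SlabRSWGluingExtB.lean`.

## Sources

* C. M. Newman, V. Tassion, W. Wu, *Critical percolation and the minimal spanning tree in slabs*,
  Comm. Pure Appl. Math. 70 (2017), arXiv:1512.09107: §3.2, Theorem 3.7 and its proof, steps (1)–(3)
  (pp. 8–10); §3.5, proof of Theorem 3.14, Case 2 (p. 17) [NewmanTassionWu2017].

## Design choices

* One radius `r = ρ + 3` for all cleared boxes `(z + B_r) ∩ R` (`z` the contact point, within `ρ` of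
  `Γ̄ ⊆ S̄`, so possibly OUTSIDE `S` by up to `ρ`): then `box ∩ S` has at least four rows and three
  columns left of `x = b`, as `exists_route` wants.
* Far/near thresholds `ρ + 3`; separation `dist*(A, C) > 4ρ + 8` as in the segment file.
-/

noncomputable section

namespace Literature.Probability.Percolation

open MeasureTheory LatticeModels SimpleGraph

namespace NTW17

variable {k : ℕ}

/-! ## The setting -/

/-- **GL (Thm. 3.7) in the extended-rectangle setting**: `S = [a,b] × [c,d]` (at least four columns
and rows) inside `R = [a,b'] × [c,d']` (`b ≤ b'`, `d ≤ d'`), target `B = {b} × [c,d]` (the right side of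
`S`), `A ⊆ S` off the column `x = b`, `C ⊆ R`.
[cite: NewmanTassionWu2017, §3.2 (Theorem 3.7, the sets S, R, A, B, C); §3.5 (proof of Theorem 3.14, Case 2)] -/
structure ExtSetup where
  /-- left column of `S` and `R` -/
  a : ℤ
  /-- right column of `S` (the side `B`) -/
  b : ℤ
  /-- bottom row of `S` and `R` -/
  c : ℤ
  /-- top row of `S` -/
  d : ℤ
  /-- right column of `R` -/
  b' : ℤ
  /-- top row of `R` -/
  d' : ℤ
  /-- the set to be reached -/
  A : Set (ℤ × ℤ)
  /-- the set to be glued -/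
  C : Set (ℤ × ℤ)
  hab : a + 3 ≤ b
  hcd : c + 3 ≤ d
  hbb' : b ≤ b'
  hdd' : d ≤ d'
  hA : A ⊆ boxR a b c d
  hAB : ∀ z ∈ A, z.1 ≠ b
  hC : C ⊆ boxR a b' c d'

namespace ExtSetup

variable (E : ExtSetup)

/-- The rectangle `S` (domain of the minimal path). [cite: NewmanTassionWu2017, §3.2 (Theorem 3.7, S)] -/
def S : Set (ℤ × ℤ) := boxR E.a E.b E.c E.d

/-- The rectangle `R ⊇ S` (domain of the glued connection). [cite: NewmanTassionWu2017, §3.2 (Theorem 3.7, R)] -/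
def R : Set (ℤ × ℤ) := boxR E.a E.b' E.c E.d'

/-- The target side `B = {b} × [c,d]`. [cite: NewmanTassionWu2017, §3.2 (Theorem 3.7, B)] -/
def B : Set (ℤ × ℤ) := {z | z ∈ E.S ∧ z.1 = E.b}

/-- `S ⊆ R`. [cite: NewmanTassionWu2017, §3.2 (Theorem 3.7)] -/
theorem S_subset_R : E.S ⊆ E.R := by
  intro z hz
  rw [S, mem_boxR_iff] at hz
  rw [R, mem_boxR_iff]
  have := E.hbb'; have := E.hdd'
  omega

/-- The gluing data `(S, R, A, B, C)`. [cite: NewmanTassionWu2017, §3.2 (Theorem 3.7)] -/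
def Q : GlueData := ⟨E.S, E.R, E.A, E.B, E.C, E.S_subset_R, boxR_finite _ _ _ _, boxR_finite _ _ _ _⟩

/-- The cleared box `(z + B_r) ∩ R`. [cite: NewmanTassionWu2017, §3.2 (proof of Theorem 3.7, the ball B_{r+2}(z))] -/
def Dbox (z : ℤ × ℤ) (r : ℕ) : Set (ℤ × ℤ) :=
  boxR (max E.a (z.1 - r)) (min E.b' (z.1 + r)) (max E.c (z.2 - r)) (min E.d' (z.2 + r))

/-- The trunk box `(z + B_r) ∩ S ∖ {x = b}`. [cite: NewmanTassionWu2017, §3.2 (proof of Theorem 3.7, the ball B_{r+1}(z) ∩ S)] -/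
def Kbox (z : ℤ × ℤ) (r : ℕ) : Set (ℤ × ℤ) :=
  boxR (max E.a (z.1 - r)) (min (E.b - 1) (z.1 + r)) (max E.c (z.2 - r)) (min E.d (z.2 + r))

/-- The branch box `(z + B_r) ∩ R ∖ {x ≥ b}`: the trunk box extended to the top of `R`.
[cite: NewmanTassionWu2017, §3.2 (proof of Theorem 3.7, the ball B_{r+2}(z))] -/
def Kplus (z : ℤ × ℤ) (r : ℕ) : Set (ℤ × ℤ) :=
  boxR (max E.a (z.1 - r)) (min (E.b - 1) (z.1 + r)) (max E.c (z.2 - r)) (min E.d' (z.2 + r))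

variable {E}

/-- Membership in `S`. [cite: NewmanTassionWu2017, §3.2 (Theorem 3.7, S)] -/
theorem mem_S_iff {z : ℤ × ℤ} : z ∈ E.S ↔ E.a ≤ z.1 ∧ z.1 ≤ E.b ∧ E.c ≤ z.2 ∧ z.2 ≤ E.d :=
  mem_boxR_iff z

/-- Membership in `R`. [cite: NewmanTassionWu2017, §3.2 (Theorem 3.7, R)] -/
theorem mem_R_iff {z : ℤ × ℤ} : z ∈ E.R ↔ E.a ≤ z.1 ∧ z.1 ≤ E.b' ∧ E.c ≤ z.2 ∧ z.2 ≤ E.d' :=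
  mem_boxR_iff z

/-- Membership in `B`. [cite: NewmanTassionWu2017, §3.2 (Theorem 3.7, B)] -/
theorem mem_B_iff {z : ℤ × ℤ} : z ∈ E.B ↔ z ∈ E.S ∧ z.1 = E.b := Iff.rfl

/-- `B ⊆ S`. [cite: NewmanTassionWu2017, §3.2 (Theorem 3.7, B ⊆ ∂S)] -/
theorem B_subset_S : E.B ⊆ E.S := fun _ h => h.1

/-- Membership in `Dbox`. [cite: NewmanTassionWu2017, §3.2 (proof of Theorem 3.7)] -/
theorem mem_Dbox_iff {z w : ℤ × ℤ} {r : ℕ} : w ∈ E.Dbox z r ↔ w ∈ E.R ∧ w ∈ sqBox z r := by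
  rw [Dbox, mem_boxR_iff, mem_R_iff, mem_sqBox_iff']
  simp only [max_le_iff, le_min_iff]
  omega

/-- Membership in `Kbox`. [cite: NewmanTassionWu2017, §3.2 (proof of Theorem 3.7)] -/
theorem mem_Kbox_iff {z w : ℤ × ℤ} {r : ℕ} : w ∈ E.Kbox z r ↔ w ∈ E.S ∧ w ∈ sqBox z r ∧ w.1 ≠ E.b := by
  rw [Kbox, mem_boxR_iff, mem_S_iff, mem_sqBox_iff']
  simp only [max_le_iff, le_min_iff]
  omega

/-- Membership in `Kplus`. [cite: NewmanTassionWu2017, §3.2 (proof of Theorem 3.7)] -/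
theorem mem_Kplus_iff {z w : ℤ × ℤ} {r : ℕ} :
    w ∈ E.Kplus z r ↔ w ∈ E.R ∧ w ∈ sqBox z r ∧ w.1 ≤ E.b - 1 := by
  rw [Kplus, mem_boxR_iff, mem_R_iff, mem_sqBox_iff']
  simp only [max_le_iff, le_min_iff]
  have := E.hbb'
  omega

/-- `Dbox ⊆ R`. [cite: NewmanTassionWu2017, §3.2 (proof of Theorem 3.7)] -/
theorem Dbox_subset_R (z : ℤ × ℤ) (r : ℕ) : E.Dbox z r ⊆ E.R := fun _ h => (mem_Dbox_iff.1 h).1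

/-- `Dbox ⊆ z + B_r`. [cite: NewmanTassionWu2017, §3.2 (proof of Theorem 3.7)] -/
theorem Dbox_subset_sqBox (z : ℤ × ℤ) (r : ℕ) : E.Dbox z r ⊆ sqBox z r := fun _ h => (mem_Dbox_iff.1 h).2

/-- `Kbox ⊆ Kplus`. [cite: NewmanTassionWu2017, §3.2 (proof of Theorem 3.7)] -/
theorem Kbox_subset_Kplus (z : ℤ × ℤ) (r : ℕ) : E.Kbox z r ⊆ E.Kplus z r := by
  intro w hw
  rw [mem_Kbox_iff, mem_S_iff] at hw
  rw [mem_Kplus_iff, mem_R_iff]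
  have := E.hbb'; have := E.hdd'
  exact ⟨by omega, hw.2.1, by omega⟩

/-- `Kplus ⊆ Dbox`. [cite: NewmanTassionWu2017, §3.2 (proof of Theorem 3.7)] -/
theorem Kplus_subset_Dbox (z : ℤ × ℤ) (r : ℕ) : E.Kplus z r ⊆ E.Dbox z r := fun _ h =>
  mem_Dbox_iff.2 ⟨(mem_Kplus_iff.1 h).1, (mem_Kplus_iff.1 h).2.1⟩

/-- `Kbox ⊆ Dbox`. [cite: NewmanTassionWu2017, §3.2 (proof of Theorem 3.7)] -/
theorem Kbox_subset_Dbox (z : ℤ × ℤ) (r : ℕ) : E.Kbox z r ⊆ E.Dbox z r :=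
  (Kbox_subset_Kplus z r).trans (Kplus_subset_Dbox z r)

/-- `Kbox ⊆ S`. [cite: NewmanTassionWu2017, §3.2 (proof of Theorem 3.7)] -/
theorem Kbox_subset_S (z : ℤ × ℤ) (r : ℕ) : E.Kbox z r ⊆ E.S := fun _ h => (mem_Kbox_iff.1 h).1

/-- `Kbox` avoids the target side. [cite: NewmanTassionWu2017, §3.2 (proof of Theorem 3.7)] -/
theorem Kbox_disjoint_B {z w : ℤ × ℤ} {r : ℕ} (h : w ∈ E.Kbox z r) : w ∉ E.B := fun hB =>
  (mem_Kbox_iff.1 h).2.2 hB.2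

/-- `Kplus` avoids the target side. [cite: NewmanTassionWu2017, §3.2 (proof of Theorem 3.7)] -/
theorem Kplus_disjoint_B {z w : ℤ × ℤ} {r : ℕ} (h : w ∈ E.Kplus z r) : w ∉ E.B := fun hB => by
  have := (mem_Kplus_iff.1 h).2.2; rw [hB.2] at this; omega

/-- A point of `S ∩ (z + B_r)` off the column `x = b` lies in `Kbox`. [cite: NewmanTassionWu2017, §3.2 (proof of Theorem 3.7)] -/
theorem mem_Kbox_of {z w : ℤ × ℤ} {r : ℕ} (hS : w ∈ E.S) (hz : w ∈ sqBox z r) (hb : w.1 ≠ E.b) :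
    w ∈ E.Kbox z r := mem_Kbox_iff.2 ⟨hS, hz, hb⟩

/-- The events of `E.Q` unfold to the data. [cite: NewmanTassionWu2017, §3.2 (Theorem 3.7)] -/
theorem Q_S : E.Q.S = E.S := rfl

/-- `E.Q.R = E.R`. [cite: NewmanTassionWu2017, §3.2 (Theorem 3.7)] -/
theorem Q_R : E.Q.R = E.R := rfl

/-- `E.Q.A = E.A`. [cite: NewmanTassionWu2017, §3.2 (Theorem 3.7)] -/
theorem Q_A : E.Q.A = E.A := rfl

/-- `E.Q.B = E.B`. [cite: NewmanTassionWu2017, §3.2 (Theorem 3.7)] -/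
theorem Q_B : E.Q.B = E.B := rfl

/-- `E.Q.C = E.C`. [cite: NewmanTassionWu2017, §3.2 (Theorem 3.7)] -/
theorem Q_C : E.Q.C = E.C := rfl

end ExtSetup

/-! ## Where a contact point can be -/

section ContactPoint

variable {E : ExtSetup} {ω : BondConfig (slab 3 k)} {ρ : ℕ}

/-- **A contact point lies within `ρ` of `S`**: if `z ∈ R` is within `ρ` of a vertex of `Γ ⊆ S̄`,
then `z.1 ≤ b + ρ` and `z.2 ≤ d + ρ` (and `a ≤ z.1`, `c ≤ z.2`).
[cite: NewmanTassionWu2017, §3.2 (proof of Theorem 3.7, step (1))] -/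
theorem contact_bounds (hA : ω ∈ E.Q.evAB k) {z : ℤ × ℤ} (hzR : z ∈ E.R)
    (hnear : Near k (E.Q.γ k ω) ρ z) :
    E.a ≤ z.1 ∧ z.1 ≤ E.b + ρ ∧ E.c ≤ z.2 ∧ z.2 ≤ E.d + ρ := by
  obtain ⟨hγO, -⟩ := E.Q.γ_spec hA
  obtain ⟨g, hg, hz⟩ := hnear
  have hgS : planar k g ∈ E.S := hγO.subset g hg
  rw [ExtSetup.mem_S_iff] at hgS
  rw [ExtSetup.mem_R_iff] at hzR
  rw [mem_sqBox_iff'] at hz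
  omega

end ContactPoint

/-! ## The plain surgery: the cleared box stays left of the column `x = b` -/

section Plain

variable {E : ExtSetup} {ω : BondConfig (slab 3 k)} {ρ : ℕ}

/-- **Contact far from `A`, `C` and the column `x = b`** (NTW, proof of Thm. 3.7, steps (1)–(3), with
`S ⊊ R`): given a normalised contact (`c₀ ∈ C̄`, an `ω`-open self-avoiding path `l ++ [q]` from `c₀`
inside `R̄` whose last vertex is within `ρ` of `Γ̄` and whose other vertices are not) with no cell of
`A` or `C` within `ρ + 3` of `z = planar q` and `z.1 + ρ + 3 ≤ b - 1`, there is a surgery whose cleared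
set is `(z + B_{ρ+3}) ∩ R`: `Γ` is rerouted inside the trunk box `(z + B_{ρ+3}) ∩ S` and the branch to
the port of the `C`-path runs in the cleared box (a top extension of the trunk box).
[cite: NewmanTassionWu2017, §3.2 (proof of Theorem 3.7, steps (1)–(3))] -/
theorem exists_surgery_ext (hk : 1 ≤ k) (hρ : 2 ≤ ρ) (hω : ω ⊆ (slabGraph 3 k).edgeSet)
    (hX : ω ∈ E.Q.evX k) {c₀ q : slab 3 k} {l : List (slab 3 k)} (hc₀ : c₀ ∈ slabLift k E.C)
    (hch : (l ++ [q]).IsChain (fun a b => s(a, b) ∈ ω ∧ a ≠ b)) (hnd : (l ++ [q]).Nodup)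
    (hsub : ∀ x ∈ l ++ [q], x ∈ slabLift k E.R) (hhead : (l ++ [q]).head (by simp) = c₀)
    (hnear : Near k (E.Q.γ k ω) ρ (planar k q)) (hfar : ∀ x ∈ l, ¬Near k (E.Q.γ k ω) ρ (planar k x))
    (hnA : ∀ a' ∈ E.A, a' ∉ sqBox (planar k q) (ρ + 3))
    (hnC : ∀ c' ∈ E.C, c' ∉ sqBox (planar k q) (ρ + 3))
    (hcol : (planar k q).1 + (ρ + 3) ≤ E.b - 1) :
    ∃ sx : E.Q.Surgery k ω, sx.D ⊆ sqBox (planar k q) (ρ + 3) := by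
  have hA : ω ∈ E.Q.evAB k := hX.1
  obtain ⟨hγO, -⟩ := E.Q.γ_spec hA
  set z := planar k q with hzdef
  set r : ℕ := ρ + 3 with hrdef
  set D := E.Dbox z r with hDdef
  set K := E.Kbox z r with hKdef
  set Kp := E.Kplus z r with hKpdef
  have hzR : z ∈ E.R := hsub q (by simp)
  obtain ⟨hz1, hz2, hz3, hz4⟩ := contact_bounds hA hzR hnear
  have hzR' := hzR
  rw [ExtSetup.mem_R_iff] at hzR'
  have hab := E.hab; have hcd := E.hcd; have hbb' := E.hbb'; have hdd' := E.hdd'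
  have hDz : D ⊆ sqBox z (ρ + 3) := ExtSetup.Dbox_subset_sqBox _ _
  have hl : l ≠ [] := contact_ne_nil (Q := E.Q) hc₀ hhead hnC
  have hzD : z ∈ D := ExtSetup.mem_Dbox_iff.2 ⟨hzR, mem_sqBox_self _ _⟩
  have hc₀D : planar k c₀ ∉ D := fun h => hnC _ hc₀ (hDz h)
  have hDA : ∀ w ∈ D, w ∉ E.Q.A := fun w hw hwA => hnA w hwA (hDz hw)
  -- in this case the cleared box lies left of the column `x = b`: it equals the branch box
  have hDKp : D ⊆ Kp := by
    intro w hw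
    rw [ExtSetup.mem_Dbox_iff] at hw
    rw [ExtSetup.mem_Kplus_iff]
    refine ⟨hw.1, hw.2, ?_⟩
    have := (mem_sqBox_iff'.1 hw.2).2.1
    omega
  have hDB : ∀ w ∈ D, w ∉ E.Q.B := fun w hw => ExtSetup.Kplus_disjoint_B (hDKp hw)
  -- the port
  obtain ⟨w', q₁, hadj, hw'D, hq₁D, hσ, hw'far⟩ :=
    exists_port (Q := E.Q) hω hch hnd hsub hhead hfar hl (by omega) hzD hc₀D
  -- two vertices of `γ` over `D`: `g₀` and its predecessor
  obtain ⟨g₀, hg₀, hz⟩ := hnear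
  have hg₀z : planar k g₀ ∈ sqBox z ρ := GlueGeom.mem_sqBox_comm hz
  have hg₀h := ne_head_of_far_A (Q := E.Q) hA hz (by omega : ρ ≤ ρ + 3) hnA
  obtain ⟨u, huγ, hadj₀, hune, -⟩ := exists_pred hω hA hg₀ hg₀h
  have hg₀D : planar k g₀ ∈ D :=
    ExtSetup.mem_Dbox_iff.2 ⟨E.S_subset_R (hγO.subset g₀ hg₀), sqBox_mono _ (by omega) hg₀z⟩
  have huD : planar k u ∈ D := by
    refine ExtSetup.mem_Dbox_iff.2 ⟨E.S_subset_R (hγO.subset u huγ), sqBox_mono _ (by omega : ρ + 1 ≤ r) ?_⟩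
    exact mem_sqBox_add hg₀z (planar_mem_sqBox_one_of_adj hadj₀.symm)
  have htwo : ∃ x ∈ E.Q.γ k ω, ∃ y ∈ E.Q.γ k ω, x ≠ y ∧ planar k x ∈ D ∧ planar k y ∈ D :=
    ⟨u, huγ, g₀, hg₀, hune, huD, hg₀D⟩
  -- a vertex of `γ` over `D` lies over the trunk box
  have hγK : ∀ v ∈ E.Q.γ k ω, planar k v ∈ D → planar k v ∈ K := by
    intro v hv hvD
    have hvS : planar k v ∈ E.S := hγO.subset v hv
    refine ExtSetup.mem_Kbox_of hvS (hDz hvD) ?_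
    have := (mem_sqBox_iff'.1 (hDz hvD)).2.1
    omega
  -- routing: trunk in `K`, branch in `Kp`
  have hroute : ∀ E₁ E₂ : slab 3 k, E₁ ∈ E.Q.γ k ω → E₂ ∈ E.Q.γ k ω → E₁ ≠ E₂ →
      planar k E₁ ∈ D → planar k E₂ ∈ D → ∃ L Br c, RouteSpec k K D E₁ E₂ w' L Br c := by
    intro E₁ E₂ hE₁ hE₂ hne hE₁D hE₂D
    have h1 : ¬Near k (E.Q.γ k ω) 0 (planar k w') := fun hn => hw'far (hn.mono (by omega))
    obtain ⟨L, Br, c, spec⟩ := exists_route (xL := max E.a (z.1 - (r : ℕ)))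
      (xR' := min (E.b - 1) (z.1 + (r : ℕ))) (xR := min (E.b - 1) (z.1 + (r : ℕ)))
      (rB := max E.c (z.2 - (r : ℕ))) (rP := min E.d (z.2 + (r : ℕ))) (rT := min E.d' (z.2 + (r : ℕ)))
      hk (by omega) le_rfl (by omega) (by omega) (hγK E₁ hE₁ hE₁D) (hγK E₂ hE₂ hE₂D)
      (hDKp hw'D) hne (ne_planar_of_not_near h1 hE₁).symm (ne_planar_of_not_near h1 hE₂).symm
    exact ⟨L, Br, c, RouteSpec.mono spec subset_rfl (ExtSetup.Kplus_subset_Dbox _ _)⟩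
  obtain ⟨sx, hsx⟩ := exists_surgery_of_route (Q := E.Q) hX (D := D) (Dt := K)
    (ExtSetup.Dbox_subset_R _ _) hDA hDB (ExtSetup.Kbox_subset_Dbox _ _) (ExtSetup.Kbox_subset_S _ _)
    htwo hadj hq₁D hc₀ hσ hroute
  exact ⟨sx, hsx ▸ hDz⟩

end Plain

/-! ## Direct gluings near `A` and near `C`, with the `C`-path in `R̄` -/

section Direct

variable {E : ExtSetup} {ω : BondConfig (slab 3 k)} {ρ : ℕ}

/-- **Direct gluing near `A`** (extended rectangle): if a cell of `A` is within `ρ + 3` of the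
contact point, the `C`-cluster (a path inside `R̄`) is glued to `Ā` inside `(planar q + B_{ρ+3}) ∩ R`.
[cite: NewmanTassionWu2017, §3.2 (proof of Theorem 3.7, steps (2)–(3), near A)] -/
theorem exists_directGlue_A_ext (hω : ω ⊆ (slabGraph 3 k).edgeSet) (hX : ω ∈ E.Q.evX k)
    (hsep : ∀ a' ∈ E.A, ∀ c' ∈ E.C, c' ∉ sqBox a' (4 * ρ + 8))
    {c₀ q : slab 3 k} {l : List (slab 3 k)} (hc₀ : c₀ ∈ slabLift k E.C)
    (hch : (l ++ [q]).IsChain (fun a b => s(a, b) ∈ ω ∧ a ≠ b)) (hnd : (l ++ [q]).Nodup)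
    (hsub : ∀ x ∈ l ++ [q], x ∈ slabLift k E.R) (hhead : (l ++ [q]).head (by simp) = c₀)
    (hA' : ∃ a' ∈ E.A, a' ∈ sqBox (planar k q) (ρ + 3)) :
    ∃ dg : DirectGlue k E.R E.C E.A ω, dg.D ⊆ sqBox (planar k q) (ρ + 3) := by
  set z := planar k q with hzdef
  set D := E.Dbox z (ρ + 3) with hDdef
  obtain ⟨a', ha', ha'z⟩ := hA'
  have hzR : z ∈ E.R := hsub q (by simp)
  have hDC : ∀ w ∈ D, w ∉ E.C := by
    intro w hw hwC
    have hwz := ExtSetup.Dbox_subset_sqBox _ _ hw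
    have : w ∈ sqBox a' ((ρ + 3) + (ρ + 3)) := mem_sqBox_add (GlueGeom.mem_sqBox_comm ha'z) hwz
    exact hsep a' ha' w hwC (sqBox_mono _ (by omega) this)
  have hc₀D : planar k c₀ ∉ D := fun h => hDC _ h hc₀
  have hheadD : planar k ((l ++ [q]).head (by simp)) ∉ D := by rw [hhead]; exact hc₀D
  have hqD : planar k q ∈ D := ExtSetup.mem_Dbox_iff.2 ⟨hzR, mem_sqBox_self _ _⟩
  obtain ⟨m, w', rest, hm, hLeq, hmD, hw'D, hedge, -, -, hconn, -⟩ :=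
    exists_entry (R := E.R) hch hnd hsub (by simp) hheadD ⟨q, by simp, hqD⟩
  rw [hhead] at hconn
  have hadj : (slabGraph 3 k).Adj (m.getLast hm) w' := (SimpleGraph.mem_edgeSet _).1 (hω hedge)
  have hw'A : planar k w' ∉ E.A :=
    not_mem_A_of_mem_contact (Q := E.Q) hX hc₀ hch hsub hhead (by rw [hLeq]; simp)
  have ha'D : a' ∈ D := ExtSetup.mem_Dbox_iff.2 ⟨E.S_subset_R (E.hA ha'), ha'z⟩
  obtain ⟨dg, hdg⟩ := exists_directGlue (R := E.R) (Src := E.C) (Tg := E.A)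
    (ExtSetup.Dbox_subset_R _ _) hDC hc₀ (hmD _ (List.getLast_mem hm)) hconn hadj hw'D hw'A ha'D ha'
  exact ⟨dg, hdg ▸ ExtSetup.Dbox_subset_sqBox _ _⟩

/-- **Direct gluing near `C`** (extended rectangle): if a cell of `C` is within `ρ + 3` of the contact
point, the `A`-cluster is glued along `Γ` to `C̄` inside `(planar g₀ + B_{2ρ+3}) ∩ R ⊆ planar q + B_{3ρ+3}`.
[cite: NewmanTassionWu2017, §3.2 (proof of Theorem 3.7, steps (2)–(3), near C)] -/
theorem exists_directGlue_C_ext (hω : ω ⊆ (slabGraph 3 k).edgeSet) (hX : ω ∈ E.Q.evX k)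
    (hsep : ∀ a' ∈ E.A, ∀ c' ∈ E.C, c' ∉ sqBox a' (4 * ρ + 8)) {q : slab 3 k}
    (hnear : Near k (E.Q.γ k ω) ρ (planar k q)) (hC' : ∃ c' ∈ E.C, c' ∈ sqBox (planar k q) (ρ + 3)) :
    ∃ dg : DirectGlue k E.R E.A E.C ω, dg.D ⊆ sqBox (planar k q) (3 * ρ + 3) := by
  have hA : ω ∈ E.Q.evAB k := hX.1
  obtain ⟨hγO, -⟩ := E.Q.γ_spec hA
  obtain ⟨g₀, hg₀, hz⟩ := hnear
  obtain ⟨c', hc', hc'z⟩ := hC'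
  set g := planar k g₀ with hgdef
  set D := E.Dbox g (2 * ρ + 3) with hDdef
  have hg₀S : g ∈ E.S := hγO.subset g₀ hg₀
  have hc'D : c' ∈ D := by
    refine ExtSetup.mem_Dbox_iff.2 ⟨E.hC hc', ?_⟩
    have := mem_sqBox_add hz hc'z
    simpa [two_mul, add_assoc, add_comm, add_left_comm] using this
  have hDA : ∀ w ∈ D, w ∉ E.A := by
    intro w hw hwA
    have hwg := ExtSetup.Dbox_subset_sqBox _ _ hw
    have h1 : c' ∈ sqBox g (2 * ρ + 3) := (ExtSetup.mem_Dbox_iff.1 hc'D).2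
    have h2 : c' ∈ sqBox w ((2 * ρ + 3) + (2 * ρ + 3)) := mem_sqBox_add (GlueGeom.mem_sqBox_comm hwg) h1
    exact hsep w hwA c' hc' (sqBox_mono _ (by omega) h2)
  have hheadD : planar k ((E.Q.γ k ω).head hγO.ne_nil) ∉ D := fun h => hDA _ h (head_mem_A hA)
  have hg₀D : planar k g₀ ∈ D := ExtSetup.mem_Dbox_iff.2 ⟨E.S_subset_R hg₀S, mem_sqBox_self _ _⟩
  have hγR : ∀ x ∈ E.Q.γ k ω, x ∈ slabLift k E.R := fun x hx =>
    slabLift_mono k E.S_subset_R (hγO.subset x hx)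
  obtain ⟨m, w', rest, hm, hγeq, hmD, hw'D, hedge, -, -, hconn, -⟩ :=
    exists_entry (R := E.R) hγO.chain hγO.nodup hγR hγO.ne_nil hheadD ⟨g₀, hg₀, hg₀D⟩
  have hadj : (slabGraph 3 k).Adj (m.getLast hm) w' := (SimpleGraph.mem_edgeSet _).1 (hω hedge)
  have hw'γ : w' ∈ E.Q.γ k ω := by rw [hγeq]; simp
  have hw'C : planar k w' ∉ E.C := fun h => not_mem_C_of_mem_γ hX hw'γ h
  obtain ⟨dg, hdg⟩ := exists_directGlue (R := E.R) (Src := E.A) (Tg := E.C)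
    (ExtSetup.Dbox_subset_R _ _) hDA (head_mem_A hA) (hmD _ (List.getLast_mem hm)) hconn hadj
    hw'D hw'C hc'D hc'
  refine ⟨dg, hdg ▸ fun w hw => ?_⟩
  have h1 := ExtSetup.Dbox_subset_sqBox _ _ hw
  have h2 : w ∈ sqBox (planar k q) (ρ + (2 * ρ + 3)) := mem_sqBox_add (GlueGeom.mem_sqBox_comm hz) h1
  exact sqBox_mono _ (by omega) h2

end Direct

end NTW17

end Literature.Probability.Percolation
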